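import Summits.ResolutionOfSingularities.ResolutionOfSingularities.Theorems.HomologicalConductorNoZenoRMinimalGermOverQuadraticTransform
import Summits.ResolutionOfSingularities.ResolutionOfSingularities.Theorems.HomologicalConductorNoZenoRFirstKindFibreCount
import HarnessLib

/-!
# Crux `NoZenoR` (stmt-ResolutionOfSingularities-19943) — the germ over the image point of a first-kind curve: the curve
# LIFTS to an integral exceptional curve of the germ resolution, and the germ has strictly FEWER exceptional curves

Route `ResolutionOfSingularities/HomologicalConductor` (cell decomp-res, hand leafhand-res-homologicalconduct-24 g0).
OURS: AI-written proof over tree theorems, weaker than expert review; nothing here is a statement of the manuscript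
under review (Hironaka 2017).  SUPPORT level, counted 0.  Def-free, fact-free.

`S` rational non-regular, `π : X → Spec S` a desingularization, `V = Bl_𝔪 Spec S`, `σ : X → V` a desingularization with
`σ ≫ (V → Spec S) = π`, `E_η` of the first kind, `v := σ η` (closed, `isClosed_singleton_apply_of_firstKind`),
`X₁ := X ×_V Spec 𝒪_{V,v}`, `π₁ := pullback.snd : X₁ → Spec 𝒪_{V,v}`, `fst : X₁ → X`:

* `fst_mem_excCurvePoints_of_mem` — `fst` maps `excCurvePoints π₁` into `{ζ ∈ excCurvePoints π | σ ζ = v}` (heights are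
  kept by the embedding `fst`, `ExcCount.height_apply_eq_of_isEmbedding`);
* `exists_mem_excCurvePoints_germ_fst_eq` — `η = fst η₁` for some `η₁ ∈ excCurvePoints π₁`;
* **`ncard_excCurvePoints_germ_lt`** — `#excCurvePoints π₁ < #excCurvePoints π` (`fst` injective +
  `ncard_excCurvePoints_over_lt_of_firstKind`).

What remains of the hypothesis `hstep` of `…MinimalNoFirstKindOfStep` after this file and [U]
(`isMinimalResolution_germ_of_isMinimalResolution`): ONLY the transfer of the first-kind numbers
`h0 π₁ (𝓘_{η₁}²) = 3·h0 π₁ 𝓘_{η₁}` from `h0 π (𝓘_η²) = 3·h0 π 𝓘_η` (lengths over `𝒪_{V,v}` versus over `S` differ by the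
factor `[κ(v) : k]`; cf. the res-L0-w44 germ package `ExcCount.h0_primeDivisorIdeal_sq_eq_three_mul_of_fst` over an affine
chart), plus `dim 𝒪_{V,v} = 2` / rationality at `v` (tree, see `…QuadraticTransformSingularFinite`).
No crux or summit statement is proved here.
-/

noncomputable section

-- single-problem summit: the doubled namespace component `ResolutionOfSingularities` is forced
set_option linter.dupNamespace false

open CategoryTheory CategoryTheory.Limits AlgebraicGeometry TopologicalSpace IsLocalRing
open Literature.AlgebraicGeometry Literature.AlgebraicGeometry.Resolution

namespace Summit.ResolutionOfSingularities.ResolutionOfSingularities.Theorems.NoZeno.FirstKind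

variable {S : Type} [CommRing S] [IsNoetherianRing S] [IsLocalRing S] [IsDomain S] [IsIntegrallyClosed S]
  {X : Scheme.{0}} (π : X ⟶ Spec (.of S))

section Germ

variable {V : Scheme.{0}} (σ : X ⟶ V) (b : V ⟶ Spec (.of S)) (hσ : σ ≫ b = π) (v : V)
  (hvc : IsClosed ({v} : Set V))

omit [IsNoetherianRing S] [IsDomain S] [IsIntegrallyClosed S] in
include hσ hvc in
/-- **`fst` maps the exceptional curves of the germ `X ×_V Spec 𝒪_{V,v} → Spec 𝒪_{V,v}` into the exceptional curves of
`π` lying over `v`** (`v` a closed point over the closed point of `S`). [folklore] -/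
theorem fst_mem_excCurvePoints_of_mem (hv : b.base v = closedPoint S)
    {ζ₁ : ↑(pullback σ (V.fromSpecStalk v))} (hζ₁ : ζ₁ ∈ excCurvePoints (A := V.presheaf.stalk v) (pullback.snd σ (V.fromSpecStalk v))) :
    (pullback.fst σ (V.fromSpecStalk v)).base ζ₁ ∈ excCurvePoints π ∧
      σ.base ((pullback.fst σ (V.fromSpecStalk v)).base ζ₁) = v := by
  have hσζ : σ.base ((pullback.fst σ (V.fromSpecStalk v)).base ζ₁) = v := by
    rw [← Scheme.Hom.comp_apply, pullback.condition, Scheme.Hom.comp_apply, hζ₁.1]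
    exact Scheme.fromSpecStalk_closedPoint
  refine ⟨⟨?_, ?_⟩, hσζ⟩
  · rw [← hσ, Scheme.Hom.comp_apply, hσζ, hv]
  · rw [ExcCount.height_apply_eq_of_isEmbedding (pullback.fst σ (V.fromSpecStalk v))
      (pullback.fst σ (V.fromSpecStalk v)).isEmbedding ζ₁ ?_]
    · exact hζ₁.2
    · intro x hx
      rw [Scheme.Pullback.range_fst, Set.mem_preimage, Scheme.range_fromSpecStalk]
      have h1 : v ⤳ σ.base x := hσζ ▸ hx.map σ.base.hom.continuous
      have h2 : σ.base x ∈ closure ({v} : Set V) := specializes_iff_mem_closure.mp h1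
      rw [hvc.closure_eq] at h2
      rw [Set.mem_setOf_eq, Set.mem_singleton_iff.mp h2]

omit [IsNoetherianRing S] [IsDomain S] [IsIntegrallyClosed S] in
include hvc in
/-- **A curve of `π` over `v` lifts to an exceptional curve of the germ**: for `η ∈ excCurvePoints π` with `σ η = v`
there is `η₁ ∈ excCurvePoints (X ×_V Spec 𝒪_{V,v} → Spec 𝒪_{V,v})` with `fst η₁ = η`. [folklore] -/
theorem exists_mem_excCurvePoints_germ_fst_eq {η : X} (hη : η ∈ excCurvePoints π) (hσv : σ.base η = v) :
    ∃ η₁ ∈ excCurvePoints (A := V.presheaf.stalk v) (pullback.snd σ (V.fromSpecStalk v)),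
      (pullback.fst σ (V.fromSpecStalk v)).base η₁ = η := by
  -- `η` is in the range of the embedding `fst`
  have hηr : η ∈ Set.range (pullback.fst σ (V.fromSpecStalk v)).base := by
    rw [Scheme.Pullback.range_fst, Set.mem_preimage, Scheme.range_fromSpecStalk, Set.mem_setOf_eq, hσv]
  obtain ⟨η₁, rfl⟩ := hηr
  refine ⟨η₁, ⟨?_, ?_⟩, rfl⟩
  · -- over the closed point: `fromSpecStalk v (snd η₁) = σ (fst η₁) = v = fromSpecStalk v (closed point)`
    apply (V.fromSpecStalk v).isEmbedding.injective
    rw [← Scheme.Hom.comp_apply, ← pullback.condition, Scheme.Hom.comp_apply, hσv]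
    exact Scheme.fromSpecStalk_closedPoint.symm
  · rw [← ExcCount.height_apply_eq_of_isEmbedding (pullback.fst σ (V.fromSpecStalk v))
      (pullback.fst σ (V.fromSpecStalk v)).isEmbedding η₁ ?_]
    · exact hη.2
    · intro x hx
      rw [Scheme.Pullback.range_fst, Set.mem_preimage, Scheme.range_fromSpecStalk]
      have h1 : v ⤳ σ.base x := hσv ▸ hx.map σ.base.hom.continuous
      have h2 : σ.base x ∈ closure ({v} : Set V) := specializes_iff_mem_closure.mp h1
      rw [hvc.closure_eq] at h2
      rw [Set.mem_setOf_eq, Set.mem_singleton_iff.mp h2]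

include hσ hvc in
/-- **The germ over the image of a first-kind curve has strictly fewer exceptional curves.**  `S` rational non-regular,
`π : X → Spec S` a desingularization, `b : V → Spec S` a blowing up of `𝔪`, `σ : X → V` proper with `σ ≫ b = π`, `E_η`
of the first kind, `v = σ η` (closed, `isClosed_singleton_apply_of_firstKind`):
`#excCurvePoints (X ×_V Spec 𝒪_{V,v} → Spec 𝒪_{V,v}) < #excCurvePoints π`.
[cite: Lipman1969, Lemma (14.1) (p. 224); Section 2, (*) (p. 203)] -/
theorem ncard_excCurvePoints_germ_lt (hdim : ringKrullDim S = 2) (hrat : HasRationalSingularity S)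
    (hsing : ¬ IsRegularLocalRing S) (hπ : IsResolution π)
    (hb : IsBlowup b (affineBlowup.idealSheaf (maximalIdeal S))) [IsProper σ]
    [IsIntegral X] [IsLocallyNoetherian X] {η : X} (hη : η ∈ excCurvePoints π)
    (hfk : h0 π (primeDivisorIdeal η ^ 2) = 3 * h0 π (primeDivisorIdeal η)) (hv : σ.base η = v) :
    Set.ncard (excCurvePoints (A := V.presheaf.stalk v) (pullback.snd σ (V.fromSpecStalk v))) <
      (excCurvePoints π).ncard := by
  have hvm : b.base v = closedPoint S := by rw [← hv, ← Scheme.Hom.comp_apply, hσ]; exact hη.1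
  refine lt_of_le_of_lt ?_ (ncard_excCurvePoints_over_lt_of_firstKind π hdim hrat hsing hπ hb σ hσ hη hfk)
  -- `fst` is injective and maps into the curves over `v = σ η`
  rw [← Set.ncard_image_of_injective _ (pullback.fst σ (V.fromSpecStalk v)).isEmbedding.injective]
  refine Set.ncard_le_ncard ?_ ((IsResolution.excCurvePoints_finite hdim hπ).subset fun ζ hζ => hζ.1)
  rintro _ ⟨ζ₁, hζ₁, rfl⟩
  obtain ⟨h1, h2⟩ := fst_mem_excCurvePoints_of_mem π σ b hσ v hvc hvm hζ₁
  exact ⟨h1, h2.trans hv.symm⟩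

end Germ

end Summit.ResolutionOfSingularities.ResolutionOfSingularities.Theorems.NoZeno.FirstKind

end
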